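import Literature.NumberTheory.CubicFields.PureCubicLatticeSemantics
import HarnessLib

/-!
# Codes of lattices of a pure cubic field: correctness of the three lattice programs

Topic `NumberTheory/CubicFields`; theorem-only sequel of `PureCubicLatticeSemantics.lean`. For
canonical input codes (Hermite normal form, `gcd(den, entries) = 1`) the programs of
`PureCubicLatticeCodes.lean` output canonical codes with the intended member sets:

* **`latScale_spec`** — `Mem (latScale (c, e)) = Mem c · val e` for `val e ≠ 0` (full rank of the
  three products `(basis row) × (row of e)` through the adjugate rows and `N(e) ≠ 0`, which is
  where the norm form enters);
* **`latProd_spec`** — `Mem (latProd (c₁, c₂))` is the subgroup generated by the products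
  `Mem c₁ · Mem c₂` (bilinearity: the nine products of basis rows generate it);
* **`latAddGen_spec`** — `Mem (latAddGen (c, e)) = Mem c + ℤ · val e`.

## References

* H. Cohen, *A Course in Computational Algebraic Number Theory*, GTM 138, Springer 1993, §4.7.1
  (modules and ideals by HNF: sum, product, multiplication by an element), §6.4.5. [Cohen1993]
-/

namespace Literature.NumberTheory.CubicFields

namespace PureCubicCodes

variable {K : Type*} [Field K]

/-! ### Full rank of the generator lists -/

/-- Products `s × t`, `s ∈ rowSpan R`, lie in the span of the three products `Rᵢ × t`. [folklore] -/
theorem mulRow_mem_rowSpan3 (a b : ℤ) (R : Rows) (t : Row) {s : Row} (hs : s ∈ rowSpan R) :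
    mulRow a b s t ∈ rowSpan (mulRow a b R.1 t, mulRow a b R.2.1 t, mulRow a b R.2.2 t) := by
  obtain ⟨u, v, w, rfl⟩ := mem_rowSpan_iff.1 hs
  rw [mulRow_combo_left]
  exact mem_rowSpan_iff.2 ⟨u, v, w, rfl⟩

/-- **Full rank of `(basis rows) × t`**: the span contains `P·N(t)·eᵢ`, `P = r₁₁ r₂₂ r₃₃`. [folklore] -/
theorem full_latScale (a b : ℤ) {R : Rows} (hR : IsEch R) (t : Row) :
    ((R.1.1 * R.2.1.2.1 * R.2.2.2.2 * normRow a b t, 0, 0) : Row) ∈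
        rowSpan (mulRow a b R.1 t, mulRow a b R.2.1 t, mulRow a b R.2.2 t) ∧
      ((0, R.1.1 * R.2.1.2.1 * R.2.2.2.2 * normRow a b t, 0) : Row) ∈
        rowSpan (mulRow a b R.1 t, mulRow a b R.2.1 t, mulRow a b R.2.2 t) ∧
      ((0, 0, R.1.1 * R.2.1.2.1 * R.2.2.2.2 * normRow a b t) : Row) ∈
        rowSpan (mulRow a b R.1 t, mulRow a b R.2.1 t, mulRow a b R.2.2 t) := by
  obtain ⟨a1, a2, a3⟩ := mulRow_adj a b t
  refine ⟨?_, ?_, ?_⟩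
  · have h := mulRow_mem_rowSpan3 a b R t (scaleRow_mem_rowSpan hR
      (t.1 ^ 2 - a * b * t.2.1 * t.2.2, a * t.2.2 ^ 2 - t.1 * t.2.1, b * t.2.1 ^ 2 - t.1 * t.2.2))
    rw [mulRow_scaleRow_left, a1] at h
    simpa [scaleRow] using h
  · have h := mulRow_mem_rowSpan3 a b R t (scaleRow_mem_rowSpan hR
      (a * b * (b * t.2.1 ^ 2 - t.1 * t.2.2), t.1 ^ 2 - a * b * t.2.1 * t.2.2, b * (a * t.2.2 ^ 2 - t.1 * t.2.1)))
    rw [mulRow_scaleRow_left, a2] at h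
    simpa [scaleRow] using h
  · have h := mulRow_mem_rowSpan3 a b R t (scaleRow_mem_rowSpan hR
      (a * b * (a * t.2.2 ^ 2 - t.1 * t.2.1), a * (b * t.2.1 ^ 2 - t.1 * t.2.2), t.1 ^ 2 - a * b * t.2.1 * t.2.2))
    rw [mulRow_scaleRow_left, a3] at h
    simpa [scaleRow] using h

/-- **Full rank of a scaled basis** inside any larger subgroup: it contains `d·P·eᵢ`. [folklore] -/
theorem full_scaled {R : Rows} (hR : IsEch R) (d : ℤ) {S : AddSubgroup Row}
    (hle : rowSpan (scaleRow d R.1, scaleRow d R.2.1, scaleRow d R.2.2) ≤ S) :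
    ((d * (R.1.1 * R.2.1.2.1 * R.2.2.2.2), 0, 0) : Row) ∈ S ∧
      ((0, d * (R.1.1 * R.2.1.2.1 * R.2.2.2.2), 0) : Row) ∈ S ∧
      ((0, 0, d * (R.1.1 * R.2.1.2.1 * R.2.2.2.2)) : Row) ∈ S := by
  refine ⟨hle ((mem_rowSpan_scale_iff d R _).2 ⟨_, scaleRow_mem_rowSpan hR (1, 0, 0), by simp [scaleRow]⟩),
    hle ((mem_rowSpan_scale_iff d R _).2 ⟨_, scaleRow_mem_rowSpan hR (0, 1, 0), by simp [scaleRow]⟩),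
    hle ((mem_rowSpan_scale_iff d R _).2 ⟨_, scaleRow_mem_rowSpan hR (0, 0, 1), by simp [scaleRow]⟩)⟩

/-- A non-zero element has non-zero norm form (given the norm form on `ℚ`-coordinates). [cite: Cohen1993, §6.4.5] -/
theorem normRow_ne_zero [NumberField K] (θ : K) {a b : ℕ}
    (hnorm : ∀ x y z : ℚ, Algebra.norm ℚ ((x : K) + (y : K) * θ + (z : K) * (θ ^ 2 / (b : K))) =
      x ^ 3 + (a * b ^ 2 : ℕ) * y ^ 3 + (a ^ 2 * b : ℕ) * z ^ 3 - 3 * (a * b : ℕ) * x * y * z)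
    {t : Row} (ht : lin θ b t ≠ 0) : normRow a b t ≠ 0 := by
  have h := hnorm t.1 t.2.1 t.2.2
  push_cast at h
  have hne : Algebra.norm ℚ (lin θ b t) ≠ 0 := Algebra.norm_ne_zero_iff.2 ht
  have hq : ((normRow a b t : ℤ) : ℚ) ≠ 0 := by
    unfold lin at hne
    rw [h] at hne
    convert hne using 1
    simp only [normRow]
    push_cast
    ring
  exact_mod_cast hq

/-! ### Lattice × element -/

/-- **`latScale` is correct**: for a canonical `c`, `den_e ≥ 1` and `val e ≠ 0`, the output is
canonical and its member set is `Mem c · val e`. [cite: Cohen1993, §4.7.1] -/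
theorem latScale_spec [NumberField K] (θ : K) {a b : ℕ} (hb : (b : K) ≠ 0) (hθ : θ ^ 3 = ((a * b ^ 2 : ℕ) : K))
    (hnorm : ∀ x y z : ℚ, Algebra.norm ℚ ((x : K) + (y : K) * θ + (z : K) * (θ ^ 2 / (b : K))) =
      x ^ 3 + (a * b ^ 2 : ℕ) * y ^ 3 + (a ^ 2 * b : ℕ) * z ^ 3 - 3 * (a * b : ℕ) * x * y * z) :
    ∀ (c : ℕ × List ℤ) (e : Elem), Canon c → 1 ≤ e.2.2.2 → val θ b e ≠ 0 →
      Canon (latScale ((a, b), (c, e))) ∧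
      ∀ φ : K, Mem θ b (latScale ((a, b), (c, e))) φ ↔ ∃ ψ : K, Mem θ b c ψ ∧ φ = ψ * val θ b e := by
  intro c e hc he hv
  obtain ⟨h11, h12, h13, h22, h23, h33, hc2, p11, p22, p33, -, -, -, -, -, -, hD, -⟩ := id hc
  have hR := rowsOf_eq_of hc2
  have hdK : ((e.2.2.2 : ℕ) : K) ≠ 0 := by exact_mod_cast (show e.2.2.2 ≠ 0 by omega)
  have hDK : ((c.1 : ℕ) : K) ≠ 0 := by exact_mod_cast (show c.1 ≠ 0 by omega)
  have ht : lin θ b (rowOfE e) ≠ 0 := fun h0 => hv (by change lin θ b (rowOfE e) / _ = 0; rw [h0, zero_div])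
  have hN : normRow (a : ℤ) (b : ℤ) (rowOfE e) ≠ 0 := normRow_ne_zero θ hnorm ht
  have hP : (rowsOf c).1.1 * (rowsOf c).2.1.2.1 * (rowsOf c).2.2.2.2 ≠ 0 := by rw [hR]; positivity
  have hfull := full_latScale (a : ℤ) (b : ℤ) (isEch_rowsOf c) (rowOfE e)
  rw [← closure_list3] at hfull
  have hDd : 1 ≤ c.1 * e.2.2.2 := Nat.mul_pos hD he
  refine ⟨canon_latOfGens hDd _ (mul_ne_zero hP hN) hfull.1 hfull.2.1 hfull.2.2, fun φ => ?_⟩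
  change Mem θ b (latOfGens (c.1 * e.2.2.2) _) φ ↔ _
  rw [mem_latOfGens_iff θ b hDd, closure_list3]
  constructor
  · rintro ⟨r, hr, er⟩
    obtain ⟨u, v, w, rfl⟩ := mem_rowSpan_iff.1 hr
    refine ⟨lin θ b (u * (rowsOf c).1.1 + v * (rowsOf c).2.1.1 + w * (rowsOf c).2.2.1,
        u * (rowsOf c).1.2.1 + v * (rowsOf c).2.1.2.1 + w * (rowsOf c).2.2.2.1,
        u * (rowsOf c).1.2.2 + v * (rowsOf c).2.1.2.2 + w * (rowsOf c).2.2.2.2) / ((c.1 : ℕ) : K),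
      mem_of_mem_rowSpan θ b hc (mem_rowSpan_iff.2 ⟨u, v, w, rfl⟩), ?_⟩
    rw [← mulRow_combo_left, lin_mulRow θ hb hθ] at er
    change φ = _ * (lin θ b (rowOfE e) / ((e.2.2.2 : ℕ) : K))
    rw [div_mul_div_comm, eq_div_iff (mul_ne_zero hDK hdK), ← er]
    push_cast
    ring
  · rintro ⟨ψ, hψ, rfl⟩
    obtain ⟨s, hs, es⟩ := (mem_iff_rowSpan θ b hc2 _).1 hψ
    refine ⟨_, mulRow_mem_rowSpan3 _ _ _ _ hs, ?_⟩
    rw [lin_mulRow θ hb hθ, ← es]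
    change _ * (ψ * (lin θ b (rowOfE e) / ((e.2.2.2 : ℕ) : K))) = _
    field_simp
    push_cast
    ring

/-! ### Lattice × lattice -/

/-- The nine generators of `latProd` are products of basis rows. [folklore] -/
theorem mem_gens9 (a b : ℤ) (R S : Rows) {x : Row}
    (hx : x ∈ [mulRow a b R.1 S.1, mulRow a b R.1 S.2.1, mulRow a b R.1 S.2.2,
      mulRow a b R.2.1 S.1, mulRow a b R.2.1 S.2.1, mulRow a b R.2.1 S.2.2,
      mulRow a b R.2.2 S.1, mulRow a b R.2.2 S.2.1, mulRow a b R.2.2 S.2.2]) :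
    ∃ s₁ ∈ rowSpan R, ∃ s₂ ∈ rowSpan S, x = mulRow a b s₁ s₂ := by
  obtain ⟨n₁, n₂, n₃⟩ := mem_rowSpan_self R
  obtain ⟨m₁, m₂, m₃⟩ := mem_rowSpan_self S
  simp only [List.mem_cons, List.not_mem_nil, or_false] at hx
  rcases hx with rfl | rfl | rfl | rfl | rfl | rfl | rfl | rfl | rfl
  exacts [⟨_, n₁, _, m₁, rfl⟩, ⟨_, n₁, _, m₂, rfl⟩, ⟨_, n₁, _, m₃, rfl⟩, ⟨_, n₂, _, m₁, rfl⟩, ⟨_, n₂, _, m₂, rfl⟩,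
    ⟨_, n₂, _, m₃, rfl⟩, ⟨_, n₃, _, m₁, rfl⟩, ⟨_, n₃, _, m₂, rfl⟩, ⟨_, n₃, _, m₃, rfl⟩]

/-- **`latProd` is correct**: for canonical `c₁, c₂` the output is canonical and its member set is
the subgroup generated by the products `Mem c₁ · Mem c₂`. [cite: Cohen1993, §4.7.1] -/
theorem latProd_spec [CharZero K] (θ : K) {a b : ℕ} (hb : (b : K) ≠ 0) (hθ : θ ^ 3 = ((a * b ^ 2 : ℕ) : K)) :
    ∀ c₁ c₂ : ℕ × List ℤ, Canon c₁ → Canon c₂ →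
      Canon (latProd ((a, b), (c₁, c₂))) ∧
      ∀ φ : K, Mem θ b (latProd ((a, b), (c₁, c₂))) φ ↔
        φ ∈ AddSubgroup.closure {ψ : K | ∃ ψ₁ ψ₂ : K, Mem θ b c₁ ψ₁ ∧ Mem θ b c₂ ψ₂ ∧ ψ = ψ₁ * ψ₂} := by
  intro c₁ c₂ hc₁ hc₂
  obtain ⟨h11, h12, h13, h22, h23, h33, hc2₁, p11, p22, p33, -, -, -, -, -, -, hD₁, -⟩ := id hc₁
  obtain ⟨g11, g12, g13, g22, g23, g33, hc2₂, q11, q22, q33, -, -, -, -, -, -, hD₂, -⟩ := id hc₂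
  have hR₁ := rowsOf_eq_of hc2₁
  have hR₂ := rowsOf_eq_of hc2₂
  have hDD : 1 ≤ c₁.1 * c₂.1 := Nat.mul_pos hD₁ hD₂
  have hDDK : ((c₁.1 * c₂.1 : ℕ) : K) ≠ 0 := by exact_mod_cast (show c₁.1 * c₂.1 ≠ 0 by positivity)
  have hP₁ : (rowsOf c₁).1.1 * (rowsOf c₁).2.1.2.1 * (rowsOf c₁).2.2.2.2 ≠ 0 := by rw [hR₁]; positivity
  have hP₂ : (rowsOf c₂).1.1 * (rowsOf c₂).2.1.2.1 * (rowsOf c₂).2.2.2.2 ≠ 0 := by rw [hR₂]; positivity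
  have m₁ := scaleRow_mem_rowSpan (isEch_rowsOf c₁)
  have m₂ := scaleRow_mem_rowSpan (isEch_rowsOf c₂)
  obtain ⟨ax1, ax2, ax3⟩ := mulRow_axes (a : ℤ) (b : ℤ) ((rowsOf c₁).1.1 * (rowsOf c₁).2.1.2.1 * (rowsOf c₁).2.2.2.2)
    ((rowsOf c₂).1.1 * (rowsOf c₂).2.1.2.1 * (rowsOf c₂).2.2.2.2)
  have e1 : ∀ P : ℤ, scaleRow P ((1, 0, 0) : Row) = (P, 0, 0) := fun P => by simp [scaleRow]
  have e2 : ∀ P : ℤ, scaleRow P ((0, 1, 0) : Row) = (0, P, 0) := fun P => by simp [scaleRow]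
  have e3 : ∀ P : ℤ, scaleRow P ((0, 0, 1) : Row) = (0, 0, P) := fun P => by simp [scaleRow]
  have f1 := mulRow_mem_closure9 (a : ℤ) (b : ℤ) (rowsOf c₁) (rowsOf c₂) (m₁ (1, 0, 0)) (m₂ (1, 0, 0))
  rw [e1, e1, ax1] at f1
  have f2 := mulRow_mem_closure9 (a : ℤ) (b : ℤ) (rowsOf c₁) (rowsOf c₂) (m₁ (0, 1, 0)) (m₂ (1, 0, 0))
  rw [e2, e1, ax2] at f2
  have f3 := mulRow_mem_closure9 (a : ℤ) (b : ℤ) (rowsOf c₁) (rowsOf c₂) (m₁ (0, 0, 1)) (m₂ (1, 0, 0))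
  rw [e3, e1, ax3] at f3
  refine ⟨canon_latOfGens hDD _ (mul_ne_zero hP₁ hP₂) f1 f2 f3, fun φ => ?_⟩
  change Mem θ b (latOfGens (c₁.1 * c₂.1) _) φ ↔ _
  rw [mem_latOfGens_iff θ b hDD]
  constructor
  · rintro ⟨r, hr, er⟩
    have hφ : φ = lin θ b r / ((c₁.1 * c₂.1 : ℕ) : K) := by rw [eq_div_iff hDDK, mul_comm]; exact er
    rw [hφ]
    clear hφ er
    induction hr using AddSubgroup.closure_induction with
    | mem x hx =>
      obtain ⟨s₁, hs₁, s₂, hs₂, rfl⟩ := mem_gens9 _ _ _ _ hx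
      refine AddSubgroup.subset_closure ⟨lin θ b s₁ / ((c₁.1 : ℕ) : K), lin θ b s₂ / ((c₂.1 : ℕ) : K),
        mem_of_mem_rowSpan θ b hc₁ hs₁, mem_of_mem_rowSpan θ b hc₂ hs₂, ?_⟩
      rw [lin_mulRow θ hb hθ, div_mul_div_comm, Nat.cast_mul]
    | zero => rw [lin_zero, zero_div]; exact AddSubgroup.zero_mem _
    | add x y _ _ ihx ihy => rw [lin_add, add_div]; exact AddSubgroup.add_mem _ ihx ihy
    | neg x _ ih => rw [lin_neg, neg_div]; exact AddSubgroup.neg_mem _ ih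
  · intro hφ
    induction hφ using AddSubgroup.closure_induction with
    | mem x hx =>
      obtain ⟨ψ₁, ψ₂, h₁, h₂, rfl⟩ := hx
      obtain ⟨s₁, hs₁, e₁⟩ := (mem_iff_rowSpan θ b hc2₁ _).1 h₁
      obtain ⟨s₂, hs₂, e₂⟩ := (mem_iff_rowSpan θ b hc2₂ _).1 h₂
      refine ⟨mulRow a b s₁ s₂, mulRow_mem_closure9 (a : ℤ) (b : ℤ) _ _ hs₁ hs₂, ?_⟩
      rw [lin_mulRow θ hb hθ, ← e₁, ← e₂]
      push_cast
      ring
    | zero => exact ⟨0, AddSubgroup.zero_mem _, by rw [lin_zero, mul_zero]⟩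
    | add x y _ _ ihx ihy =>
      obtain ⟨r₁, hr₁, e₁⟩ := ihx
      obtain ⟨r₂, hr₂, e₂⟩ := ihy
      exact ⟨r₁ + r₂, AddSubgroup.add_mem _ hr₁ hr₂, by rw [mul_add, e₁, e₂, lin_add]⟩
    | neg x _ ih =>
      obtain ⟨r, hr, e⟩ := ih
      exact ⟨-r, AddSubgroup.neg_mem _ hr, by rw [mul_neg, e, lin_neg]⟩

/-! ### Lattice + one generator -/

/-- **`latAddGen` is correct**: for a canonical `c` and `den_e ≥ 1` the output is canonical and its
member set is `Mem c + ℤ · val e`. [cite: Cohen1993, §4.7.1] -/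
theorem latAddGen_spec [CharZero K] (θ : K) (a b : ℕ) :
    ∀ (c : ℕ × List ℤ) (e : Elem), Canon c → 1 ≤ e.2.2.2 →
      Canon (latAddGen ((a, b), (c, e))) ∧
      ∀ φ : K, Mem θ b (latAddGen ((a, b), (c, e))) φ ↔
        ∃ (ψ : K) (k : ℤ), Mem θ b c ψ ∧ φ = ψ + (k : K) * val θ b e := by
  intro c e hc he
  obtain ⟨h11, h12, h13, h22, h23, h33, hc2, p11, p22, p33, -, -, -, -, -, -, hD, -⟩ := id hc
  have hR := rowsOf_eq_of hc2
  have hdK : ((e.2.2.2 : ℕ) : K) ≠ 0 := by exact_mod_cast (show e.2.2.2 ≠ 0 by omega)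
  have hDK : ((c.1 : ℕ) : K) ≠ 0 := by exact_mod_cast (show c.1 ≠ 0 by omega)
  have hP : (rowsOf c).1.1 * (rowsOf c).2.1.2.1 * (rowsOf c).2.2.2.2 ≠ 0 := by rw [hR]; positivity
  have hd : (e.2.2.2 : ℤ) ≠ 0 := by exact_mod_cast (show e.2.2.2 ≠ 0 by omega)
  have hDd : 1 ≤ c.1 * e.2.2.2 := Nat.mul_pos hD he
  have hfull := full_scaled (isEch_rowsOf c) (e.2.2.2 : ℤ)
    (S := AddSubgroup.closure {x | x ∈ [scaleRow (e.2.2.2 : ℤ) (rowsOf c).1, scaleRow (e.2.2.2 : ℤ) (rowsOf c).2.1,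
      scaleRow (e.2.2.2 : ℤ) (rowsOf c).2.2, scaleRow (c.1 : ℤ) (rowOfE e)]})
    (by rw [closure_list4]; exact le_sup_left)
  refine ⟨canon_latOfGens hDd _ (mul_ne_zero hd hP) hfull.1 hfull.2.1 hfull.2.2, fun φ => ?_⟩
  change Mem θ b (latOfGens (c.1 * e.2.2.2) _) φ ↔ _
  rw [mem_latOfGens_iff θ b hDd, closure_list4]
  constructor
  · rintro ⟨r, hr, er⟩
    obtain ⟨u, v, w, k, rfl⟩ := mem_rowSpan_sup_iff.1 hr
    refine ⟨lin θ b (u * (rowsOf c).1.1 + v * (rowsOf c).2.1.1 + w * (rowsOf c).2.2.1,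
        u * (rowsOf c).1.2.1 + v * (rowsOf c).2.1.2.1 + w * (rowsOf c).2.2.2.1,
        u * (rowsOf c).1.2.2 + v * (rowsOf c).2.1.2.2 + w * (rowsOf c).2.2.2.2) / ((c.1 : ℕ) : K), k,
      mem_of_mem_rowSpan θ b hc (mem_rowSpan_iff.2 ⟨u, v, w, rfl⟩), ?_⟩
    rw [lin_combo4, lin_scaleRow, lin_scaleRow, lin_scaleRow, lin_scaleRow] at er
    push_cast at er
    rw [lin_combo3]
    change φ = _ + _ * (lin θ b (rowOfE e) / ((e.2.2.2 : ℕ) : K))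
    rw [mul_div_assoc', div_add_div _ _ hDK hdK, eq_div_iff (mul_ne_zero hDK hdK)]
    linear_combination er
  · rintro ⟨ψ, k, hψ, rfl⟩
    obtain ⟨s, hs, es⟩ := (mem_iff_rowSpan θ b hc2 _).1 hψ
    obtain ⟨u, v, w, rfl⟩ := mem_rowSpan_iff.1 hs
    refine ⟨_, mem_rowSpan_sup_iff.2 ⟨u, v, w, k, rfl⟩, ?_⟩
    rw [lin_combo4, lin_scaleRow, lin_scaleRow, lin_scaleRow, lin_scaleRow]
    rw [lin_combo3] at es
    change _ * (ψ + _ * (lin θ b (rowOfE e) / ((e.2.2.2 : ℕ) : K))) = _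
    have hψ' : ψ = ((u : K) * lin θ b (rowsOf c).1 + (v : K) * lin θ b (rowsOf c).2.1 +
        (w : K) * lin θ b (rowsOf c).2.2) / ((c.1 : ℕ) : K) := by
      rw [eq_div_iff hDK, mul_comm]; exact es
    rw [hψ']
    field_simp
    push_cast
    ring

end PureCubicCodes

end Literature.NumberTheory.CubicFields
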